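import Literature.Barriers.QuantumFields.FiniteTemperatureInfraredExplicitProofs
import Mathlib.MeasureTheory.Integral.Marginal
import HarnessLib

/-!
# The temporal gauge and the transfer-matrix (spin-model) representation of the
# finite-temperature lattice gauge theory at zero space-like coupling

For the Borgs–Seiler/Tomboulis–Yaffe finite-temperature Wilson theory on `ℤ_{L₀} × (ℤ/L)^d`
(`Literature.Barriers.QuantumFields.FiniteTemperature`: `Config`, `weight ρ J_E J_M`, `haar`,
`polyakovLine`) with **zero space-like coupling** `J_M = 0`, the time direction integrates
exactly: "one makes a change of variables (gauge transformation) which effectively sets to one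
all timelike link variables except for those that end in the spacelike slice `Λ_s`, which are
transformed into the twist `Ω[x]`" [cite: TomboulisYaffe1985, §III (3.11)–(3.12), p. 323], and
then every space-like bond `⟨y, y+e_i⟩` carries an independent ring of `L₀` link integrals, the
(`L₀`-th power of the) transfer matrix `T` of (3.12).  The outcome is an `SU(N)`- (here: compact
`G`-) spin model for the Polyakov lines `Ω` with Haar a-priori measure and nearest-neighbour
Boltzmann factor `transferKernel ρ J L₀ (Ω_y, Ω_{y+e_i})`:

`∫ F(Ω(U)) e^{J Σ_{P ∋ e_0} Re tr ρ(U_P)} ∏dU = ∫_{G^{Λ_s}} F(Ω) ∏_{⟨y,i⟩} K_{L₀}(Ω_y, Ω_{y+e_i}) ∏dΩ`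

(`lintegral_polyakov_mul_weight_eq_lintegral_transferKernel`, stated with `∫⁻` and for every
measurable `F ≥ 0`; any compact metrisable `G`, any continuous representation `ρ`, any `d, L₀, L`).

## Structure (the printed derivation, made explicit)

* §1 `lmarginal` book-keeping (Mathlib's iterated marginals `∫⋯∫⁻_s`): factors that do not
  depend on the integrated coordinates pull out, and a product of functions supported on
  pairwise disjoint coordinate blocks integrates to the product of the block integrals.
* §2 the temporal gauge: the skew shift `W_{(t,y),i} = T_{t,y} U_{(t,y),i} T_{t,y+e_i}⁻¹`,
  `T_{t,y} = U_{(0,y),0} ⋯ U_{(t-1,y),0}` the partial Polyakov line, preserves `∏dU`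
  (`measurePreserving_skewShift` of the tree) and fixes the Polyakov lines; composed with it, the
  gauge transformation by `T` turns `U` into its temporal-gauge representative `temporalRep`
  (time-like links `1`, except the last layer which carries `Ω`), and the Wilson weight is gauge
  invariant.
* §3 at `J_M = 0` the weight of a temporal-gauge configuration is the product over bonds of ring
  factors; the marginal of one ring over its `L₀` space-like links is the transfer kernel
  `transferKernel` evaluated at the two Polyakov lines [cite: TomboulisYaffe1985, §III (3.12), p. 323].
* §4 integrating the time-like links: the Polyakov lines of independent Haar links are
  independent Haar elements (the product of `L₀` independent Haar-distributed group elements is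
  Haar distributed).
* §5 assembly.
-/

open MeasureTheory Filter Topology Function
open scoped ENNReal
open Literature.MathematicalPhysics.QuantumFieldTheory (haarProbability)
open Literature.Barriers.QuantumFields Literature.Barriers.QuantumFields.FiniteTemperature
  Literature.Barriers.QuantumFields.FiniteTemperature.SliceRP

namespace Literature.MathematicalPhysics.QuantumFieldTheory.TomboulisYaffeHighTemperature

noncomputable section

/-! ### §1. Book-keeping for iterated marginals -/

section Marginal

variable {δ : Type*} {X : δ → Type*} [∀ i, MeasurableSpace (X i)] {μ : ∀ i, Measure (X i)}
  [DecidableEq δ]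

/-- A factor not depending on the integrated coordinates pulls out of an iterated marginal (on
the left). [cite: Dudley2002, Thm 4.4.5 (Tonelli–Fubini), p. 137] -/
theorem lmarginal_mul_left_of_dependsOn (s : Finset δ) {T : Set δ} {f g : (∀ i, X i) → ℝ≥0∞}
    (hf : DependsOn f T) (hT : ∀ i ∈ s, i ∉ T) (hg : Measurable g) :
    ∫⋯∫⁻_s, (fun x => f x * g x) ∂μ = fun x => f x * (∫⋯∫⁻_s, g ∂μ) x := by
  ext x
  simp only [lmarginal]
  have h : ∀ y : ∀ i : s, X i, f (updateFinset x s y) = f x := fun y =>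
    hf fun i hi => by
      simp only [updateFinset]
      rw [dif_neg (fun h => hT i h hi)]
  simp_rw [h]
  exact lintegral_const_mul _ (hg.comp measurable_updateFinset)

/-- A factor not depending on the integrated coordinates pulls out of an iterated marginal (on
the right). [cite: Dudley2002, Thm 4.4.5 (Tonelli–Fubini), p. 137] -/
theorem lmarginal_mul_right_of_dependsOn (s : Finset δ) {T : Set δ} {f g : (∀ i, X i) → ℝ≥0∞}
    (hf : DependsOn f T) (hT : ∀ i ∈ s, i ∉ T) (hg : Measurable g) :
    ∫⋯∫⁻_s, (fun x => g x * f x) ∂μ = fun x => (∫⋯∫⁻_s, g ∂μ) x * f x := by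
  have h := lmarginal_mul_left_of_dependsOn (μ := μ) s hf hT hg
  simp_rw [mul_comm (g _)] 
  rw [h]; ext x; exact mul_comm _ _

/-- An iterated marginal over `s` of a function of the coordinates in `T` is a function of the
coordinates in `T \ s`. [folklore] -/
private theorem dependsOn_lmarginal (s : Finset δ) {T : Set δ} {f : (∀ i, X i) → ℝ≥0∞}
    (hf : DependsOn f T) : DependsOn (∫⋯∫⁻_s, f ∂μ) (T \ ↑s) := by
  intro x y hxy
  simp only [lmarginal]
  refine lintegral_congr fun z => hf fun i hi => ?_
  by_cases his : i ∈ s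
  · simp [updateFinset, his]
  · simp only [updateFinset, dif_neg his]
    exact hxy i ⟨hi, by simpa using his⟩

omit [∀ i, MeasurableSpace (X i)] [DecidableEq δ] in
/-- A finite product of functions of the coordinates in `T b` is a function of the coordinates in
`⋃_b T b`. [folklore] -/
private theorem dependsOn_finset_prod {β : Type*} (B : Finset β) (T : β → Set δ)
    (g : β → (∀ i, X i) → ℝ≥0∞) (hgT : ∀ b ∈ B, DependsOn (g b) (T b)) :
    DependsOn (fun x => ∏ b ∈ B, g b x) (⋃ b ∈ B, T b) := by
  intro x y hxy
  exact Finset.prod_congr rfl fun b hb => hgT b hb fun i hi =>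
    hxy i (Set.mem_biUnion (show b ∈ (B : Set β) from hb) hi)

/-- The iterated marginal of a constant over probability measures is the constant. [folklore] -/
private theorem lmarginal_const [∀ i, IsProbabilityMeasure (μ i)] (s : Finset δ) (c : ℝ≥0∞) :
    ∫⋯∫⁻_s, (fun _ => c) ∂μ = fun _ : ∀ i, X i => c := by
  ext x
  simp [lmarginal]

/-- Two functions agreeing on the fibre `{updateFinset x s y}` have the same marginal at `x`.
[folklore] -/
private theorem lmarginal_congr_of_eq_on_update (s : Finset δ) {f g : (∀ i, X i) → ℝ≥0∞} (x : ∀ i, X i)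
    (h : ∀ y : ∀ i : s, X i, f (updateFinset x s y) = g (updateFinset x s y)) :
    (∫⋯∫⁻_s, f ∂μ) x = (∫⋯∫⁻_s, g ∂μ) x := by
  simp only [lmarginal]
  exact lintegral_congr h

variable [∀ i, SigmaFinite (μ i)]

/-- **Disjoint blocks integrate independently.** If the functions `g_b` (`b ∈ B`) depend on
coordinate sets `T_b`, the coordinate blocks `S_b` are pairwise disjoint and `S_{b'}` does not
meet `T_b` for `b' ≠ b`, then the iterated marginal over `⋃_b S_b` of `∏_b g_b` is the product
of the marginals of the `g_b` over their own blocks. [cite: Dudley2002, Thm 4.4.5 (Tonelli–Fubini), p. 137] -/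
theorem lmarginal_biUnion_prod_eq_prod {β : Type*} [DecidableEq β] (B : Finset β)
    (S : β → Finset δ) (T : β → Set δ) (g : β → (∀ i, X i) → ℝ≥0∞)
    (hgm : ∀ b, Measurable (g b)) (hgT : ∀ b, DependsOn (g b) (T b))
    (hST : ∀ b ∈ B, ∀ b' ∈ B, b ≠ b' → ∀ i ∈ S b', i ∉ T b)
    (hSS : ∀ b ∈ B, ∀ b' ∈ B, b ≠ b' → Disjoint (S b) (S b')) :
    ∫⋯∫⁻_(B.biUnion S), (fun x => ∏ b ∈ B, g b x) ∂μ =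
      fun x => ∏ b ∈ B, (∫⋯∫⁻_(S b), g b ∂μ) x := by
  induction B using Finset.induction with
  | empty =>
      ext x
      simp [lmarginal_empty]
  | @insert b₀ B hb₀ ih =>
      have hST' : ∀ b ∈ B, ∀ b' ∈ B, b ≠ b' → ∀ i ∈ S b', i ∉ T b := fun b hb b' hb' =>
        hST b (Finset.mem_insert_of_mem hb) b' (Finset.mem_insert_of_mem hb')
      have hSS' : ∀ b ∈ B, ∀ b' ∈ B, b ≠ b' → Disjoint (S b) (S b') := fun b hb b' hb' =>
        hSS b (Finset.mem_insert_of_mem hb) b' (Finset.mem_insert_of_mem hb')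
      have ih' := ih hST' hSS'
      have hdis : Disjoint (S b₀) (B.biUnion S) := by
        rw [Finset.disjoint_biUnion_right]
        intro b hb
        exact hSS b₀ (Finset.mem_insert_self _ _) b (Finset.mem_insert_of_mem hb)
          (fun h => hb₀ (h ▸ hb))
      have hmB : Measurable fun x : ∀ i, X i => ∏ b ∈ B, g b x :=
        Finset.measurable_prod _ fun b _ => hgm b
      rw [Finset.biUnion_insert, lmarginal_union μ _ (Finset.measurable_prod _ fun b _ => hgm b) hdis]
      simp_rw [Finset.prod_insert hb₀]
      -- pull `g b₀` out of the inner marginal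
      have h1 : ∫⋯∫⁻_(B.biUnion S), (fun x => g b₀ x * ∏ b ∈ B, g b x) ∂μ =
          fun x => g b₀ x * (∫⋯∫⁻_(B.biUnion S), (fun x => ∏ b ∈ B, g b x) ∂μ) x :=
        lmarginal_mul_left_of_dependsOn _ (hgT b₀) (fun i hi => by
          obtain ⟨b, hb, hib⟩ := Finset.mem_biUnion.mp hi
          exact hST b₀ (Finset.mem_insert_self _ _) b (Finset.mem_insert_of_mem hb)
            (fun h => hb₀ (h ▸ hb)) i hib) hmB
      rw [h1, ih']
      -- pull the product of the other marginals out of the outer marginal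
      have hdep : DependsOn (fun x : ∀ i, X i => ∏ b ∈ B, (∫⋯∫⁻_(S b), g b ∂μ) x)
          (⋃ b ∈ B, (T b \ ↑(S b))) :=
        dependsOn_finset_prod B (fun b => T b \ ↑(S b)) (fun b => ∫⋯∫⁻_(S b), g b ∂μ)
          fun b _ => dependsOn_lmarginal (S b) (hgT b)
      have hmP : Measurable fun x : ∀ i, X i => ∏ b ∈ B, (∫⋯∫⁻_(S b), g b ∂μ) x :=
        Finset.measurable_prod _ fun b _ => (hgm b).lmarginal μ
      have h2 := lmarginal_mul_right_of_dependsOn (μ := μ) (S b₀) hdep (fun i hi hmem => by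
        simp only [Set.mem_iUnion, Set.mem_sdiff, Finset.mem_coe] at hmem
        obtain ⟨b, hb, hiT, -⟩ := hmem
        exact hST b (Finset.mem_insert_of_mem hb) b₀ (Finset.mem_insert_self _ _)
          (fun h => hb₀ (h ▸ hb)) i hi hiT) (hgm b₀)
      rw [h2]

end Marginal

/-! ### §2. The temporal gauge -/

section Gauge

variable {d L₀ L : ℕ} {G : Type*} [Group G] {N : ℕ}

/-- The partial Polyakov line `T_{t,y} = U_{(0,y),0} U_{(1,y),0} ⋯ U_{(t−1,y),0}` at the site
`x = (t, y)` (`t.val` factors; `T_{0,y} = 1`, and `T_{L₀−1,y} U_{(L₀−1,y),0} = Ω_y`). [cite: TomboulisYaffe1985, §III after (3.12), p. 323] -/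
def partialLine [NeZero L₀] (U : Config d L₀ L G) (x : FiniteTemperature.Site d L₀ L) : G :=
  timeHolonomy U x.1.val ((0 : ZMod L₀), x.2)

/-- The space-like links `((t, y), i)`, `i` a spatial direction. [folklore] -/
def spaceLinks (d L₀ L : ℕ) [NeZero L₀] [NeZero L] : Finset (FiniteTemperature.Site d L₀ L × Dir d) :=
  Finset.univ.filter fun e => e.2 ≠ none

/-- The time-like links `((t, y), 0)`. [folklore] -/
def timeLinks (d L₀ L : ℕ) [NeZero L₀] [NeZero L] : Finset (FiniteTemperature.Site d L₀ L × Dir d) :=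
  Finset.univ.filter fun e => e.2 = none

omit [Group G] in
/-- Membership. [folklore] -/
@[simp] private theorem mem_spaceLinks [NeZero L₀] [NeZero L] (e : FiniteTemperature.Site d L₀ L × Dir d) :
    e ∈ spaceLinks d L₀ L ↔ e.2 ≠ none := by
  simp [spaceLinks]

omit [Group G] in
/-- Membership. [folklore] -/
@[simp] private theorem mem_timeLinks [NeZero L₀] [NeZero L] (e : FiniteTemperature.Site d L₀ L × Dir d) :
    e ∈ timeLinks d L₀ L ↔ e.2 = none := by
  simp [timeLinks]

omit [Group G] in
/-- Every link is time-like or space-like. [folklore] -/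
private theorem timeLinks_union_spaceLinks [NeZero L₀] [NeZero L] :
    timeLinks d L₀ L ∪ spaceLinks d L₀ L = Finset.univ := by
  ext e; by_cases h : e.2 = none <;> simp [h]

omit [Group G] in
/-- No link is both. [folklore] -/
private theorem disjoint_timeLinks_spaceLinks [NeZero L₀] [NeZero L] :
    Disjoint (timeLinks d L₀ L) (spaceLinks d L₀ L) := by
  rw [Finset.disjoint_left]; intro e h1 h2; simp_all

/-- **The temporal gauge fixing** as a skew shift of the space-like links:
`W_{(t,y),i} = T_{t,y} U_{(t,y),i} T_{t,y+e_i}⁻¹`, time-like links unchanged. [cite: TomboulisYaffe1985, §III after (3.12), p. 323] -/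
def temporalGaugeFix [NeZero L₀] (U : Config d L₀ L G) : Config d L₀ L G := fun e =>
  if e.2 = none then U e else partialLine U e.1 * U e * (partialLine U (e.1.shift e.2))⁻¹

/-- **The temporal-gauge representative**: the time-like links are `1` except on the last layer
`t = L₀ − 1`, where they carry the Polyakov line ("the twist `Ω[x]`"); the space-like links are
kept. [cite: TomboulisYaffe1985, §III after (3.12), p. 323] -/
def temporalRep [NeZero L₀] (U : Config d L₀ L G) : Config d L₀ L G := fun e =>
  if e.2 = none then (if e.1.1 + 1 = 0 then polyakovLine U e.1.2 else 1) else U e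

/-- Pointwise form. [folklore] -/
@[simp] private theorem temporalGaugeFix_apply_none [NeZero L₀] (U : Config d L₀ L G) (x : FiniteTemperature.Site d L₀ L) :
    temporalGaugeFix U (x, none) = U (x, none) := by
  simp [temporalGaugeFix]

/-- Pointwise form. [folklore] -/
@[simp] private theorem temporalGaugeFix_apply_some [NeZero L₀] (U : Config d L₀ L G) (x : FiniteTemperature.Site d L₀ L)
    (i : Fin d) :
    temporalGaugeFix U (x, some i) =
      partialLine U x * U (x, some i) * (partialLine U (x.shift (some i)))⁻¹ := by
  simp [temporalGaugeFix]

/-- Pointwise form. [folklore] -/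
@[simp] private theorem temporalRep_apply_none [NeZero L₀] (U : Config d L₀ L G) (x : FiniteTemperature.Site d L₀ L) :
    temporalRep U (x, none) = if x.1 + 1 = 0 then polyakovLine U x.2 else 1 := by
  simp [temporalRep]

/-- Pointwise form. [folklore] -/
@[simp] private theorem temporalRep_apply_some [NeZero L₀] (U : Config d L₀ L G) (x : FiniteTemperature.Site d L₀ L)
    (i : Fin d) : temporalRep U (x, some i) = U (x, some i) := by
  simp [temporalRep]

/-- In `ℤ_{n+1}`: `↑n = −1`. [folklore] -/
private theorem natCast_eq_neg_one (n : ℕ) : ((n : ℕ) : ZMod (n + 1)) = -1 :=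
  eq_neg_of_add_eq_zero_left (by exact_mod_cast ZMod.natCast_self (n + 1))

/-- If `t + 1 ≠ 0` in `ℤ_{L₀}` then `t.val + 1 < L₀` and `(t+1).val = t.val + 1`. [folklore] -/
private theorem val_add_one_of_add_one_ne_zero [NeZero L₀] {t : ZMod L₀} (ht : t + 1 ≠ 0) :
    (t + 1).val = t.val + 1 ∧ t.val + 1 < L₀ := by
  obtain ⟨n, hn⟩ := Nat.exists_eq_succ_of_ne_zero (NeZero.ne L₀)
  subst hn
  rcases n with _ | n
  · exact absurd (Subsingleton.elim _ _) ht
  have hlt : t.val + 1 < n + 1 + 1 := by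
    have h1 : t.val < n + 1 + 1 := ZMod.val_lt t
    have h2 : t.val ≠ n + 1 := fun h => ht (by
      have : t = ((n + 1 : ℕ) : ZMod (n + 1 + 1)) :=
        calc t = ((t.val : ℕ) : ZMod (n + 1 + 1)) := (ZMod.natCast_zmod_val t).symm
          _ = ((n + 1 : ℕ) : ZMod (n + 1 + 1)) := by rw [h]
      rw [this, natCast_eq_neg_one, neg_add_cancel])
    omega
  have h1 : (1 : ZMod (n + 1 + 1)).val = 1 := by
    rw [ZMod.val_one_eq_one_mod]; exact Nat.one_mod_eq_one.mpr (by omega)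
  refine ⟨?_, hlt⟩
  rw [ZMod.val_add_of_lt (by rw [h1]; exact hlt), h1]

/-- `t + 1 = 0` in `ℤ_{L₀}` forces `t.val = L₀ − 1`, i.e. `t.val + 1 = L₀`. [folklore] -/
private theorem val_add_one_eq_of_add_one_eq_zero [NeZero L₀] {t : ZMod L₀} (ht : t + 1 = 0) :
    t.val + 1 = L₀ := by
  obtain ⟨n, hn⟩ := Nat.exists_eq_succ_of_ne_zero (NeZero.ne L₀)
  subst hn
  have : t = -1 := eq_neg_of_add_eq_zero_left ht
  rw [this, ZMod.val_neg_one]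

/-- The partial line one step later: `T_{t+1,y} = T_{t,y} U_{(t,y),0}` before the wrap-around,
and `T_{0,y} = 1` at it. [folklore] -/
private theorem partialLine_shift_none [NeZero L₀] (U : Config d L₀ L G) (x : FiniteTemperature.Site d L₀ L) :
    partialLine U (x.shift none) = if x.1 + 1 = 0 then 1 else partialLine U x * U (x, none) := by
  obtain ⟨t, y⟩ := x
  have hs : FiniteTemperature.Site.shift (t, y) none = (t + 1, y) := rfl
  rw [hs]
  simp only [partialLine]
  split_ifs with ht
  · rw [ht, ZMod.val_zero]; rfl
  · rw [(val_add_one_of_add_one_ne_zero ht).1, timeHolonomy_succ_right, zero_add, ZMod.natCast_zmod_val]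

/-- At the wrap-around `T_{L₀−1,y} U_{(L₀−1,y),0} = Ω_y`. [folklore] -/
private theorem partialLine_mul_eq_polyakovLine [NeZero L₀] (U : Config d L₀ L G) (x : FiniteTemperature.Site d L₀ L)
    (ht : x.1 + 1 = 0) : partialLine U x * U (x, none) = polyakovLine U x.2 := by
  obtain ⟨t, y⟩ := x
  have hv : t.val + 1 = L₀ := val_add_one_eq_of_add_one_eq_zero ht
  calc partialLine U (t, y) * U ((t, y), none)
      = timeHolonomy U t.val ((0 : ZMod L₀), y) * U ((0 + (t.val : ZMod L₀), y), none) := by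
        rw [zero_add, ZMod.natCast_zmod_val]; rfl
    _ = timeHolonomy U (t.val + 1) ((0 : ZMod L₀), y) := (timeHolonomy_succ_right U t.val 0 y).symm
    _ = timeHolonomy U L₀ ((0 : ZMod L₀), y) := by rw [hv]
    _ = polyakovLine U y := rfl

/-- Two configurations with the same time-like links have the same time-like holonomies.
[folklore] -/
private theorem timeHolonomy_eq_of_none_eq {U V : Config d L₀ L G}
    (h : ∀ x : FiniteTemperature.Site d L₀ L, U (x, none) = V (x, none)) (n : ℕ) (x : FiniteTemperature.Site d L₀ L) :
    timeHolonomy U n x = timeHolonomy V n x := by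
  obtain ⟨t, y⟩ := x
  exact timeHolonomy_congr n t y fun j _ => h _

/-- The temporal gauge fixing does not touch the time-like links, hence not the Polyakov lines.
[cite: TomboulisYaffe1985, §III (3.11)–(3.12), p. 323] -/
theorem polyakovLine_temporalGaugeFix [NeZero L₀] (U : Config d L₀ L G) :
    polyakovLine (temporalGaugeFix U) = polyakovLine U := by
  funext y
  exact timeHolonomy_eq_of_none_eq (fun x => temporalGaugeFix_apply_none U x) _ _

/-- **Gauge transforming by the partial lines is the temporal gauge**: `T · U` is the temporal-gauge
representative of the skew-shifted configuration. [cite: TomboulisYaffe1985, §III after (3.12), p. 323] -/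
theorem gaugeAct_partialLine [NeZero L₀] (U : Config d L₀ L G) :
    gaugeAct (partialLine U) U = temporalRep (temporalGaugeFix U) := by
  funext e
  obtain ⟨x, μ⟩ := e
  rcases μ with _ | i
  · rw [gaugeAct_apply, temporalRep_apply_none, partialLine_shift_none, polyakovLine_temporalGaugeFix]
    split_ifs with ht
    · rw [inv_one, mul_one, partialLine_mul_eq_polyakovLine U x ht]
    · rw [mul_inv_cancel]
  · rw [gaugeAct_apply, temporalRep_apply_some, temporalGaugeFix_apply_some]

variable (ρ : G →* Matrix (Fin N) (Fin N) ℂ)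

/-- **Gauge invariance of the Wilson action.** [cite: BorgsSeiler1983, §III.1 Prop. III.2 (p. 345)] -/
theorem minusAction_gaugeAct [NeZero L₀] [NeZero L] (JE JM : ℝ) (g : FiniteTemperature.Site d L₀ L → G)
    (U : Config d L₀ L G) : minusAction ρ JE JM (gaugeAct g U) = minusAction ρ JE JM U := by
  have key : ∀ (x : FiniteTemperature.Site d L₀ L) (P : G), (ρ (g x * P * (g x)⁻¹)).trace.re = (ρ P).trace.re :=
    fun x P => by simpa using trace_re_rep_conj ρ (g x)⁻¹ P
  simp only [minusAction, plaquette_gaugeAct, key]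

/-- **Gauge invariance of the Boltzmann weight.** [cite: BorgsSeiler1983, §III.1 Prop. III.2 (p. 345)] -/
theorem weight_gaugeAct [NeZero L₀] [NeZero L] (JE JM : ℝ) (g : FiniteTemperature.Site d L₀ L → G)
    (U : Config d L₀ L G) : weight ρ JE JM (gaugeAct g U) = weight ρ JE JM U := by
  rw [weight, weight, minusAction_gaugeAct]

/-- **The weight in the temporal gauge**: `e^{−S(U)} = e^{−S(temporalRep (temporalGaugeFix U))}`.
[cite: TomboulisYaffe1985, §III (3.11)–(3.12), p. 323] -/
theorem weight_eq_weight_temporalRep [NeZero L₀] [NeZero L] (JE JM : ℝ) (U : Config d L₀ L G) :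
    weight ρ JE JM U = weight ρ JE JM (temporalRep (temporalGaugeFix U)) := by
  rw [← gaugeAct_partialLine, weight_gaugeAct]

variable [TopologicalSpace G] [IsTopologicalGroup G] [CompactSpace G] [MeasurableSpace G]
  [BorelSpace G]

omit [CompactSpace G] [MeasurableSpace G] [BorelSpace G] in
/-- The partial lines are continuous in the configuration. [folklore] -/
private theorem continuous_partialLine [NeZero L₀] (x : FiniteTemperature.Site d L₀ L) :
    Continuous fun U : Config d L₀ L G => partialLine U x :=
  continuous_timeHolonomy _ _

omit [TopologicalSpace G] [IsTopologicalGroup G] [CompactSpace G] [MeasurableSpace G]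
  [BorelSpace G] in
/-- The partial lines read only time-like links. [folklore] -/
private theorem dependsOn_partialLine [NeZero L₀] [NeZero L] (x : FiniteTemperature.Site d L₀ L) :
    DependsOn (fun U : Config d L₀ L G => partialLine U x)
      (((spaceLinks d L₀ L)ᶜ : Finset (FiniteTemperature.Site d L₀ L × Dir d)) : Set (FiniteTemperature.Site d L₀ L × Dir d)) := by
  intro U V h
  exact timeHolonomy_eq_of_none_eq (fun z => h _ (by simp)) _ _

variable [SecondCountableTopology G]

/-- **The temporal gauge fixing preserves the a-priori measure** (a two-sided skew shift of the
space-like links by functions of the time-like links). [cite: TomboulisYaffe1985, §III (3.11)–(3.12), p. 323] -/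
theorem measurePreserving_temporalGaugeFix [NeZero L₀] [NeZero L] :
    MeasurePreserving (temporalGaugeFix (d := d) (L₀ := L₀) (L := L) (G := G))
      (haar d L₀ L G) (haar d L₀ L G) := by
  classical
  have key := measurePreserving_skewShift (ι := FiniteTemperature.Site d L₀ L × Dir d) (G := G) (haarProbability G)
    (spaceLinks d L₀ L) (fun e U => partialLine U e.1) (fun e U => (partialLine U (e.1.shift e.2))⁻¹)
    (fun e => (continuous_partialLine e.1).measurable)
    (fun e => (continuous_partialLine _).measurable.inv)
    (fun e => dependsOn_partialLine e.1)
    (fun e => by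
      intro U V h
      have h' := dependsOn_partialLine (L₀ := L₀) (L := L) (G := G) (e.1.shift e.2) h
      simp only at h' ⊢
      rw [h'])
  unfold haar
  convert key using 1
  funext U e
  by_cases he : e.2 = none
  · simp [temporalGaugeFix, he]
  · simp [temporalGaugeFix, he]

end Gauge

/-! ### §3. Zero space-like coupling: ring factors and the transfer kernel -/

section Transfer

variable {d L₀ L : ℕ} {G : Type*} [Group G] {N : ℕ} (ρ : G →* Matrix (Fin N) (Fin N) ℂ)

/-- The ring plaquette of a temporal-gauge configuration along one bond: `W_{t+1} W_t⁻¹` before the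
wrap-around and `Ω W_0 Ω'⁻¹ W_{L₀−1}⁻¹` at it (`U_Ω[l] = Ω[x] U[l] Ω[y]†` for `l = ⟨xy⟩`). [cite: TomboulisYaffe1985, §III (3.11)–(3.12), p. 323] -/
def twistPlaq (g g' : G) (W : ZMod L₀ → G) (t : ZMod L₀) : G :=
  (if t + 1 = 0 then g else 1) * W (t + 1) * (if t + 1 = 0 then g' else 1)⁻¹ * (W t)⁻¹

/-- The one-plaquette electric Boltzmann factor `e^{J Re tr ρ(U_P)}` (in `ℝ≥0∞`). [cite: TomboulisYaffe1985, §III (3.12), p. 323] -/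
def plaqFactor (J : ℝ) (P : G) : ℝ≥0∞ := ENNReal.ofReal (Real.exp (J * (ρ P).trace.re))

/-- The ring factor of the bond `b = ⟨y, y + e_i⟩`: the product of the `L₀` electric Boltzmann
factors of the plaquettes above `b`, in the temporal gauge (a function of the two Polyakov lines
and of the `L₀` space-like links above `b`). [cite: TomboulisYaffe1985, §III (3.12), p. 323] -/
def ringFactor [NeZero L₀] (J : ℝ) (b : (Fin d → ZMod L) × Fin d) (U : Config d L₀ L G) : ℝ≥0∞ :=
  ∏ t : ZMod L₀, plaqFactor ρ J (twistPlaq (polyakovLine U b.1)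
    (polyakovLine U (b.1 + Pi.single b.2 1)) (fun s => U ((s, b.1), some b.2)) t)

/-- The space-like links above the bond `b = ⟨y, y + e_i⟩`. [folklore] -/
def bondLinks [NeZero L₀] [NeZero L] (b : (Fin d → ZMod L) × Fin d) :
    Finset (FiniteTemperature.Site d L₀ L × Dir d) :=
  Finset.univ.filter fun e => e.1.2 = b.1 ∧ e.2 = some b.2

/-- The links a ring factor reads: all time-like links and the space-like links above its bond.
[folklore] -/
def ringSupport (L₀ : ℕ) (b : (Fin d → ZMod L) × Fin d) : Set (FiniteTemperature.Site d L₀ L × Dir d) :=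
  {e | e.2 = none ∨ (e.1.2 = b.1 ∧ e.2 = some b.2)}

omit [Group G] in
/-- Membership. [folklore] -/
@[simp] private theorem mem_bondLinks [NeZero L₀] [NeZero L] (b : (Fin d → ZMod L) × Fin d)
    (e : FiniteTemperature.Site d L₀ L × Dir d) :
    e ∈ bondLinks (L₀ := L₀) b ↔ e.1.2 = b.1 ∧ e.2 = some b.2 := by
  simp [bondLinks]

omit [Group G] in
/-- The space-like links are the disjoint union of the bond rings. [folklore] -/
private theorem spaceLinks_eq_biUnion_bondLinks [NeZero L₀] [NeZero L] :
    spaceLinks d L₀ L = Finset.univ.biUnion (bondLinks (d := d) (L₀ := L₀) (L := L)) := by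
  ext ⟨x, μ⟩
  rcases μ with _ | i
  · simp
  · simp only [mem_spaceLinks, ne_eq, reduceCtorEq, not_false_eq_true, Finset.mem_biUnion,
      Finset.mem_univ, mem_bondLinks, Option.some.injEq, true_and, true_iff]
    exact ⟨(x.2, i), rfl, rfl⟩

/-- In the temporal gauge the electric plaquettes above a bond are the ring plaquettes. [cite: TomboulisYaffe1985, §III (3.11)–(3.12), p. 323] -/
theorem plaquette_temporalRep [NeZero L₀] (U : Config d L₀ L G) (t : ZMod L₀) (y : Fin d → ZMod L)
    (i : Fin d) :
    plaquette (temporalRep U) (t, y) none (some i) =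
      twistPlaq (polyakovLine U y) (polyakovLine U (y + Pi.single i 1)) (fun s => U ((s, y), some i)) t := by
  simp [plaquette, twistPlaq, FiniteTemperature.Site.shift]

/-- **The weight at zero space-like coupling, in the temporal gauge, is the product of the ring
factors.** [cite: TomboulisYaffe1985, §III (3.11)–(3.12), p. 323] -/
theorem ofReal_weight_temporalRep [NeZero L₀] [NeZero L] (J : ℝ) (U : Config d L₀ L G) :
    ENNReal.ofReal (weight ρ J 0 (temporalRep U)) =
      ∏ b : (Fin d → ZMod L) × Fin d, ringFactor ρ J b U := by
  have h1 : weight ρ J 0 (temporalRep U) = ∏ x : FiniteTemperature.Site d L₀ L, ∏ i : Fin d,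
      Real.exp (J * (ρ (plaquette (temporalRep U) x none (some i))).trace.re) := by
    rw [weight, minusAction, zero_mul, add_zero, Finset.mul_sum, Real.exp_sum]
    refine Finset.prod_congr rfl fun x _ => ?_
    rw [Finset.mul_sum, Real.exp_sum]
  rw [h1, ENNReal.ofReal_prod_of_nonneg (fun x _ => Finset.prod_nonneg fun i _ => (Real.exp_pos _).le)]
  simp_rw [ENNReal.ofReal_prod_of_nonneg (fun i _ => (Real.exp_pos _).le)]
  rw [Fintype.prod_prod_type, Finset.prod_comm, Fintype.prod_prod_type]
  refine Finset.prod_congr rfl fun y _ => ?_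
  rw [Finset.prod_comm]
  refine Finset.prod_congr rfl fun i _ => ?_
  simp only [ringFactor, plaqFactor, plaquette_temporalRep]

/-- A ring factor reads only the time-like links and the space-like links above its bond.
[folklore] -/
private theorem dependsOn_ringFactor [NeZero L₀] (J : ℝ) (b : (Fin d → ZMod L) × Fin d) :
    DependsOn (ringFactor (L₀ := L₀) (G := G) ρ J b) (ringSupport L₀ b) := by
  intro U V h
  have hΩ : polyakovLine U = polyakovLine V :=
    funext fun y => timeHolonomy_eq_of_none_eq (fun x => h (x, none) (Or.inl rfl)) _ _
  have hW : (fun s : ZMod L₀ => U ((s, b.1), some b.2)) = fun s => V ((s, b.1), some b.2) :=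
    funext fun s => h _ (Or.inr ⟨rfl, rfl⟩)
  simp only [ringFactor, hΩ, hW]

variable [TopologicalSpace G] [IsTopologicalGroup G] [CompactSpace G] [MeasurableSpace G]
  [BorelSpace G]

omit [CompactSpace G] [MeasurableSpace G] [BorelSpace G] in
/-- The ring plaquettes are continuous in the configuration. [folklore] -/
private theorem continuous_twistPlaq_config [NeZero L₀] (t : ZMod L₀) (y y' : Fin d → ZMod L) (i : Fin d) :
    Continuous fun U : Config d L₀ L G =>
      twistPlaq (polyakovLine U y) (polyakovLine U y') (fun s => U ((s, y), some i)) t := by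
  unfold twistPlaq
  refine ((Continuous.mul ?_ (continuous_link _)).mul (Continuous.inv ?_)).mul (continuous_link _).inv
  · by_cases h : t + 1 = 0
    · simp only [h, if_true]; exact continuous_timeHolonomy _ _
    · simp only [h, if_false]; exact continuous_const
  · by_cases h : t + 1 = 0
    · simp only [h, if_true]; exact continuous_timeHolonomy _ _
    · simp only [h, if_false]; exact continuous_const

omit [IsTopologicalGroup G] [CompactSpace G] [MeasurableSpace G] [BorelSpace G] in
/-- The one-plaquette factor is continuous for a continuous representation. [cite: TomboulisYaffe1985, §III (3.11)–(3.12), p. 323] -/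
theorem continuous_plaqFactor (hρ : Continuous ρ) (J : ℝ) : Continuous (plaqFactor ρ J) := by
  unfold plaqFactor
  exact ENNReal.continuous_ofReal.comp (Real.continuous_exp.comp (continuous_const.mul
    (Complex.continuous_re.comp ((Continuous.matrix_trace hρ)))))

omit [CompactSpace G] [MeasurableSpace G] [BorelSpace G] in
/-- The ring integrand is jointly continuous in the two twists and the ring variables. [cite: TomboulisYaffe1985, §III (3.11)–(3.12), p. 323] -/
theorem continuous_twistPlaq [NeZero L₀] (t : ZMod L₀) :
    Continuous fun p : (G × G) × (ZMod L₀ → G) => twistPlaq p.1.1 p.1.2 p.2 t := by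
  unfold twistPlaq
  refine ((Continuous.mul ?_ ((continuous_apply _).comp continuous_snd)).mul
    (Continuous.inv ?_)).mul ((continuous_apply _).comp continuous_snd).inv
  · by_cases h : t + 1 = 0
    · simp only [h, if_true]; exact continuous_fst.comp continuous_fst
    · simp only [h, if_false]; exact continuous_const
  · by_cases h : t + 1 = 0
    · simp only [h, if_true]; exact continuous_snd.comp continuous_fst
    · simp only [h, if_false]; exact continuous_const

variable [SecondCountableTopology G]

omit [CompactSpace G] in
/-- The ring factors are measurable. [folklore] -/
private theorem measurable_ringFactor [NeZero L₀] [NeZero L] (hρ : Continuous ρ) (J : ℝ) (b : (Fin d → ZMod L) × Fin d) :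
    Measurable (ringFactor (L₀ := L₀) (G := G) ρ J b) := by
  refine Finset.measurable_prod _ fun t _ => ?_
  exact ((continuous_plaqFactor ρ hρ J).comp (continuous_twistPlaq_config t _ _ _)).measurable

/-- **The transfer kernel** `K_{L₀}(Ω, Ω') = ∫_{G^{L₀}} ∏_t e^{J Re tr ρ(ring plaquette_t)} ∏_t dW_t`:
the `L₀`-th power of Tomboulis–Yaffe's transfer matrix `T` of (3.12), as an integral kernel in
the two twists. [cite: TomboulisYaffe1985, §III (3.12), p. 323] -/
def transferKernel (L₀ : ℕ) [NeZero L₀] (J : ℝ) (g g' : G) : ℝ≥0∞ :=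
  ∫⁻ W : ZMod L₀ → G, ∏ t, plaqFactor ρ J (twistPlaq g g' W t) ∂Measure.pi fun _ => haarProbability G

end Transfer

section RingMarginal

variable {d L₀ L : ℕ} {G : Type*} [Group G] {N : ℕ} (ρ : G →* Matrix (Fin N) (Fin N) ℂ)
  [TopologicalSpace G] [IsTopologicalGroup G] [CompactSpace G] [MeasurableSpace G] [BorelSpace G]
  [SecondCountableTopology G]

omit [TopologicalSpace G] [IsTopologicalGroup G] [CompactSpace G] [MeasurableSpace G] [BorelSpace G]
  [SecondCountableTopology G] [Group G] in
/-- The ring `t ↦ ((t, y), i)` enumerates the links above the bond `⟨y, y + e_i⟩`. [folklore] -/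
def bondEquiv [NeZero L₀] [NeZero L] (b : (Fin d → ZMod L) × Fin d) :
    ZMod L₀ ≃ ↥(bondLinks (d := d) (L₀ := L₀) (L := L) b) where
  toFun s := ⟨((s, b.1), some b.2), by simp⟩
  invFun e := e.1.1.1
  left_inv s := rfl
  right_inv e := by
    obtain ⟨⟨⟨s, y⟩, μ⟩, he⟩ := e
    simp only [mem_bondLinks] at he
    obtain ⟨rfl, rfl⟩ := he
    rfl

omit [SecondCountableTopology G] in
/-- **The space-like links of one bond integrate to the transfer kernel**: the marginal of the
ring factor of `b = ⟨y, y'⟩` over the `L₀` links above `b` is `K_{L₀}(Ω_y, Ω_{y'})`. [cite: TomboulisYaffe1985, §III (3.11)–(3.12), p. 323] -/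
theorem lmarginal_bondLinks_ringFactor [NeZero L₀] [NeZero L] (J : ℝ) (b : (Fin d → ZMod L) × Fin d)
    (x : Config d L₀ L G) :
    (∫⋯∫⁻_(bondLinks b), ringFactor ρ J b ∂fun _ => haarProbability G) x =
      transferKernel ρ L₀ J (polyakovLine x b.1) (polyakovLine x (b.1 + Pi.single b.2 1)) := by
  classical
  have hmem : ∀ s : ZMod L₀, (((s, b.1), some b.2) : FiniteTemperature.Site d L₀ L × Dir d) ∈
      bondLinks (L₀ := L₀) b := fun s => by simp
  -- Step 1: the integrand on the fibre over `x`
  have h1 : ∀ z : ∀ e : ↥(bondLinks (d := d) (L₀ := L₀) (L := L) b), G,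
      ringFactor ρ J b (updateFinset x (bondLinks b) z) =
      ∏ t, plaqFactor ρ J (twistPlaq (polyakovLine x b.1) (polyakovLine x (b.1 + Pi.single b.2 1))
        (fun s => z ⟨((s, b.1), some b.2), hmem s⟩) t) := by
    intro z
    have hΩ : polyakovLine (updateFinset x (bondLinks b) z) = polyakovLine x :=
      funext fun y => timeHolonomy_eq_of_none_eq (fun x' => by
        simp only [updateFinset]
        rw [dif_neg (by simp)]) _ _
    have hW : (fun s : ZMod L₀ => updateFinset x (bondLinks b) z ((s, b.1), some b.2)) =
        fun s => z ⟨((s, b.1), some b.2), hmem s⟩ := by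
      funext s; simp only [updateFinset]; rw [dif_pos (hmem s)]
    simp only [ringFactor, hΩ, hW]
  simp only [lmarginal]
  simp_rw [h1]
  -- Step 2: transport the integral along `bondEquiv`
  have hmp := measurePreserving_piCongrLeft (fun _ : ↥(bondLinks (d := d) (L₀ := L₀) (L := L) b) =>
    haarProbability G) (bondEquiv (d := d) (L₀ := L₀) (L := L) b)
  rw [MeasurePreserving.lintegral_map_equiv _ _ hmp, transferKernel]
  have happ : ∀ (W : ZMod L₀ → G) (s : ZMod L₀),
      (MeasurableEquiv.piCongrLeft (fun _ => G) (bondEquiv (d := d) (L₀ := L₀) (L := L) b) W)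
        ⟨((s, b.1), some b.2), hmem s⟩ = W s := fun W s => by
    have hs : (bondEquiv (d := d) (L₀ := L₀) (L := L) b) s = ⟨((s, b.1), some b.2), hmem s⟩ := rfl
    rw [← hs]
    exact MeasurableEquiv.piCongrLeft_apply_apply (β := fun _ => G)
      (bondEquiv (d := d) (L₀ := L₀) (L := L) b) W s
  simp_rw [happ]

/-- The transfer kernel is jointly measurable in the two twists. [cite: TomboulisYaffe1985, §III (3.11)–(3.12), p. 323] -/
theorem measurable_transferKernel [NeZero L₀] (hρ : Continuous ρ) (J : ℝ) :
    Measurable fun p : G × G => transferKernel ρ L₀ J p.1 p.2 := by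
  unfold transferKernel
  refine Measurable.lintegral_prod_right'
    (f := fun q : (G × G) × (ZMod L₀ → G) => ∏ t, plaqFactor ρ J (twistPlaq q.1.1 q.1.2 q.2 t)) ?_
  exact Finset.measurable_prod _ fun t _ =>
    ((continuous_plaqFactor ρ hρ J).comp (continuous_twistPlaq t)).measurable

end RingMarginal

/-! ### §4. Integrating the time-like links: Polyakov lines of Haar links are Haar -/

section TimeLike

variable {d L₀ L : ℕ} {G : Type*} [Group G]
  [TopologicalSpace G] [IsTopologicalGroup G] [CompactSpace G] [MeasurableSpace G] [BorelSpace G]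
  [SecondCountableTopology G]

omit [Group G] [TopologicalSpace G] [IsTopologicalGroup G] [CompactSpace G] [MeasurableSpace G]
  [BorelSpace G] [SecondCountableTopology G] in
/-- The time-like links at the spatial site `y`. [folklore] -/
def siteTimeLinks [NeZero L₀] [NeZero L] (y : Fin d → ZMod L) :
    Finset (FiniteTemperature.Site d L₀ L × Dir d) :=
  Finset.univ.filter fun e => e.1.2 = y ∧ e.2 = none

omit [Group G] [TopologicalSpace G] [IsTopologicalGroup G] [CompactSpace G] [MeasurableSpace G]
  [BorelSpace G] [SecondCountableTopology G] in
/-- Membership. [folklore] -/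
@[simp] private theorem mem_siteTimeLinks [NeZero L₀] [NeZero L] (y : Fin d → ZMod L)
    (e : FiniteTemperature.Site d L₀ L × Dir d) :
    e ∈ siteTimeLinks (L₀ := L₀) y ↔ e.1.2 = y ∧ e.2 = none := by
  simp [siteTimeLinks]

omit [Group G] [TopologicalSpace G] [IsTopologicalGroup G] [CompactSpace G] [MeasurableSpace G]
  [BorelSpace G] [SecondCountableTopology G] in
/-- The time-like links are the disjoint union over spatial sites of the time circles. [folklore] -/
private theorem timeLinks_eq_biUnion_siteTimeLinks [NeZero L₀] [NeZero L] :
    timeLinks d L₀ L = Finset.univ.biUnion (siteTimeLinks (d := d) (L₀ := L₀) (L := L)) := by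
  ext ⟨x, μ⟩
  rcases μ with _ | i
  · simp only [mem_timeLinks, Finset.mem_biUnion, Finset.mem_univ, mem_siteTimeLinks, and_true,
      true_and, true_iff]
    exact ⟨x.2, rfl⟩
  · simp

omit [TopologicalSpace G] [IsTopologicalGroup G] [CompactSpace G] [MeasurableSpace G]
  [BorelSpace G] [SecondCountableTopology G] in
/-- Polyakov lines at other sites do not read the time circle at `y`. [folklore] -/
private theorem polyakovLine_eq_of_eq_off_site [NeZero L₀] {U V : Config d L₀ L G} {y y' : Fin d → ZMod L}
    (hy : y' ≠ y) (h : ∀ e : FiniteTemperature.Site d L₀ L × Dir d, ¬ (e.1.2 = y ∧ e.2 = none) → U e = V e) :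
    polyakovLine U y' = polyakovLine V y' :=
  timeHolonomy_congr L₀ 0 y' fun j _ => h _ (by simp [hy])

omit [TopologicalSpace G] [IsTopologicalGroup G] [CompactSpace G] [MeasurableSpace G]
  [BorelSpace G] [SecondCountableTopology G] in
/-- Replacing the first time-like link at `y` by `g` multiplies the Polyakov line at `y` on the
left: `Ω_y(U[e₀ ↦ g]) = g · (U_{(1,y),0} ⋯ U_{(L₀−1,y),0})`. [folklore] -/
private theorem polyakovLine_update_first [NeZero L₀] (U : Config d L₀ L G) (y : Fin d → ZMod L) :
    ∃ c : G, ∀ g : G, polyakovLine (Function.update U (((0 : ZMod L₀), y), none) g) y = g * c := by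
  classical
  obtain ⟨n, hn⟩ := Nat.exists_eq_succ_of_ne_zero (NeZero.ne L₀)
  subst hn
  refine ⟨timeHolonomy U n (((0 : ZMod (n + 1)) + 1, y)), fun g => ?_⟩
  have h0 : polyakovLine (Function.update U (((0 : ZMod (n + 1)), y), none) g) y =
      Function.update U (((0 : ZMod (n + 1)), y), none) g (((0 : ZMod (n + 1)), y), none) *
        timeHolonomy (Function.update U (((0 : ZMod (n + 1)), y), none) g) n ((0 : ZMod (n + 1)) + 1, y) :=
    rfl
  rw [h0, Function.update_self, timeHolonomy_congr (V := U) n (0 + 1) y fun j hj => ?_]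
  rw [Function.update_of_ne]
  simp only [ne_eq, Prod.mk.injEq, and_true]
  intro h
  exfalso
  have hval : ((0 : ZMod (n + 1)) + 1 + (j : ZMod (n + 1))).val = j + 1 := by
    have hc : (0 : ZMod (n + 1)) + 1 + (j : ZMod (n + 1)) = ((j + 1 : ℕ) : ZMod (n + 1)) := by
      push_cast; ring
    rw [hc, ZMod.val_natCast, Nat.mod_eq_of_lt (by omega)]
  rw [h, ZMod.val_zero] at hval
  omega

/-- **One time circle integrates to one Haar element**: the marginal over the `L₀` time-like links
at `y` of a function of the Polyakov lines is the Haar integral over the Polyakov line at `y`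
(the product of `L₀` independent Haar-distributed elements is Haar distributed). [cite: TomboulisYaffe1985, §III (3.11)–(3.12), p. 323] -/
theorem lmarginal_siteTimeLinks_comp_polyakovLine [NeZero L₀] [NeZero L] (y : Fin d → ZMod L)
    (Ψ : ((Fin d → ZMod L) → G) → ℝ≥0∞) (hΨ : Measurable Ψ) (x : Config d L₀ L G) :
    (∫⋯∫⁻_(siteTimeLinks y), (fun U => Ψ (polyakovLine U)) ∂fun _ => haarProbability G) x =
      ∫⁻ g, Ψ (Function.update (polyakovLine x) y g) ∂haarProbability G := by
  classical
  set e₀ : FiniteTemperature.Site d L₀ L × Dir d := (((0 : ZMod L₀), y), none) with he₀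
  have he₀mem : e₀ ∈ siteTimeLinks (L₀ := L₀) y := by simp [he₀]
  have hmΩ : Measurable fun U : Config d L₀ L G => polyakovLine U :=
    measurable_pi_lambda _ fun y' => (continuous_timeHolonomy _ _).measurable
  have hm : Measurable fun U : Config d L₀ L G => Ψ (polyakovLine U) := hΨ.comp hmΩ
  rw [lmarginal_erase' _ hm he₀mem]
  -- the inner integral over the first link is the Haar integral of `g ↦ Ψ(Ω[y ↦ g])`
  have hinner : (fun U : Config d L₀ L G => ∫⁻ g, Ψ (polyakovLine (Function.update U e₀ g))
      ∂haarProbability G) = fun U => ∫⁻ g, Ψ (Function.update (polyakovLine U) y g) ∂haarProbability G := by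
    funext U
    obtain ⟨c, hc⟩ := polyakovLine_update_first U y
    have hupd : ∀ g, polyakovLine (Function.update U e₀ g) = Function.update (polyakovLine U) y (g * c) := by
      intro g; funext y'
      by_cases hy : y' = y
      · subst hy; rw [Function.update_self, he₀, hc]
      · rw [Function.update_of_ne hy]
        exact polyakovLine_eq_of_eq_off_site hy fun e he => Function.update_of_ne (by
          rintro rfl; exact he (by simp [he₀])) _ _
    simp_rw [hupd]
    exact lintegral_mul_right_eq_self (fun g => Ψ (Function.update (polyakovLine U) y g)) c
  rw [hinner]
  -- the remaining integrand does not read the other links of the time circle at `y`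
  have hconst : ∀ z : ∀ e : ↥((siteTimeLinks (L₀ := L₀) y).erase e₀), G,
      ∫⁻ g, Ψ (Function.update (polyakovLine (updateFinset x ((siteTimeLinks y).erase e₀) z)) y g)
        ∂haarProbability G =
      ∫⁻ g, Ψ (Function.update (polyakovLine x) y g) ∂haarProbability G := by
    intro z
    have hΩ : ∀ g, Function.update (polyakovLine (updateFinset x ((siteTimeLinks y).erase e₀) z)) y g =
        Function.update (polyakovLine x) y g := by
      intro g; funext y'
      by_cases hy : y' = y
      · subst hy; rw [Function.update_self, Function.update_self]
      · rw [Function.update_of_ne hy, Function.update_of_ne hy]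
        refine polyakovLine_eq_of_eq_off_site hy fun e he => ?_
        simp only [updateFinset]
        rw [dif_neg]
        intro hmem
        exact he ((mem_siteTimeLinks y e).mp (Finset.mem_of_mem_erase hmem))
    simp only [hΩ]
  rw [lmarginal_congr_of_eq_on_update ((siteTimeLinks y).erase e₀)
    (f := fun U : Config d L₀ L G => ∫⁻ g, Ψ (Function.update (polyakovLine U) y g) ∂haarProbability G)
    (g := fun _ => ∫⁻ g, Ψ (Function.update (polyakovLine x) y g) ∂haarProbability G) x hconst,
    lmarginal_const]

/-- **The time-like links integrate to independent Haar twists**: for a measurable function `Ψ`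
of the Polyakov lines, the marginal over all time-like links is the integral of `Ψ` against the
product Haar measure on `G^{Λ_s}` (the spin-model a-priori measure `∏_x dΩ[x]`). [cite: TomboulisYaffe1985, §III (3.11), p. 323] -/
theorem lmarginal_timeLinks_comp_polyakovLine [NeZero L₀] [NeZero L]
    (Ψ : ((Fin d → ZMod L) → G) → ℝ≥0∞) (hΨ : Measurable Ψ) (x : Config d L₀ L G) :
    (∫⋯∫⁻_(timeLinks d L₀ L), (fun U => Ψ (polyakovLine U)) ∂fun _ => haarProbability G) x =
      ∫⁻ Ω, Ψ Ω ∂Measure.pi fun _ : Fin d → ZMod L => haarProbability G := by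
  classical
  have hmΩ : Measurable fun U : Config d L₀ L G => polyakovLine U :=
    measurable_pi_lambda _ fun y' => (continuous_timeHolonomy _ _).measurable
  -- induction over sets of spatial sites
  have key : ∀ (Y : Finset (Fin d → ZMod L)) (Φ : ((Fin d → ZMod L) → G) → ℝ≥0∞), Measurable Φ →
      ∀ x : Config d L₀ L G,
      (∫⋯∫⁻_(Y.biUnion (siteTimeLinks (L₀ := L₀))), (fun U => Φ (polyakovLine U))
        ∂fun _ => haarProbability G) x =
      (∫⋯∫⁻_Y, Φ ∂fun _ : Fin d → ZMod L => haarProbability G) (polyakovLine x) := by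
    intro Y
    induction Y using Finset.induction with
    | empty => intro Φ _ x; simp
    | @insert y Y hy ih =>
        intro Φ hΦ x
        have hdis : Disjoint (siteTimeLinks (L₀ := L₀) y) (Y.biUnion (siteTimeLinks (L₀ := L₀))) := by
          rw [Finset.disjoint_biUnion_right]
          intro y' hy'
          rw [Finset.disjoint_left]
          intro e h1 h2
          rw [mem_siteTimeLinks] at h1 h2
          exact hy (h1.1.symm.trans h2.1 ▸ hy')
        rw [Finset.biUnion_insert, lmarginal_union (fun _ => haarProbability G)
          (fun U : Config d L₀ L G => Φ (polyakovLine U)) (hΦ.comp hmΩ) hdis]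
        have ih' : (∫⋯∫⁻_(Y.biUnion (siteTimeLinks (L₀ := L₀))), (fun U => Φ (polyakovLine U))
            ∂fun _ => haarProbability G) =
            fun U : Config d L₀ L G => (∫⋯∫⁻_Y, Φ ∂fun _ : Fin d → ZMod L => haarProbability G)
              (polyakovLine U) := funext (ih Φ hΦ)
        rw [ih', lmarginal_siteTimeLinks_comp_polyakovLine y _ (hΦ.lmarginal _) x,
          lmarginal_insert _ hΦ hy]
  have h := key Finset.univ Ψ hΨ x
  rwa [← timeLinks_eq_biUnion_siteTimeLinks, lmarginal_univ] at h

end TimeLike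

/-! ### §5. The spin-model representation -/

section Assembly

variable {d L₀ L : ℕ} {G : Type*} [Group G] {N : ℕ} (ρ : G →* Matrix (Fin N) (Fin N) ℂ)
  [TopologicalSpace G] [IsTopologicalGroup G] [CompactSpace G] [MeasurableSpace G] [BorelSpace G]
  [SecondCountableTopology G]

omit [CompactSpace G] [MeasurableSpace G] [BorelSpace G] [SecondCountableTopology G] [Group G] in
/-- Distinct bonds have disjoint rings of space-like links. [folklore] -/
private theorem disjoint_bondLinks [NeZero L₀] [NeZero L] {b b' : (Fin d → ZMod L) × Fin d} (hbb' : b ≠ b') :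
    Disjoint (bondLinks (d := d) (L₀ := L₀) (L := L) b) (bondLinks b') := by
  rw [Finset.disjoint_left]
  intro e h1 h2
  rw [mem_bondLinks] at h1 h2
  exact hbb' (Prod.ext (h1.1.symm.trans h2.1) (Option.some_injective _ (h1.2.symm.trans h2.2)))

omit [CompactSpace G] [MeasurableSpace G] [BorelSpace G] [SecondCountableTopology G] [Group G] in
/-- The ring of `b'` does not meet the support of the ring factor of `b ≠ b'`. [folklore] -/
private theorem not_mem_ringSupport_of_mem_bondLinks [NeZero L₀] [NeZero L] {b b' : (Fin d → ZMod L) × Fin d}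
    (hbb' : b ≠ b') {e : FiniteTemperature.Site d L₀ L × Dir d} (he : e ∈ bondLinks (L₀ := L₀) b') :
    e ∉ ringSupport L₀ b := by
  rw [mem_bondLinks] at he
  rintro (h0 | ⟨h1, h2⟩)
  · rw [he.2] at h0; exact Option.some_ne_none _ h0
  · exact hbb' (Prod.ext (h1.symm.trans he.1) (Option.some_injective _ (h2.symm.trans he.2)))

/-- **The space-like links integrate bond by bond to transfer kernels.** [cite: TomboulisYaffe1985, §III (3.11)–(3.12), p. 323] -/
theorem lmarginal_spaceLinks_polyakov_mul_ringFactors [NeZero L₀] [NeZero L] (hρ : Continuous ρ)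
    (J : ℝ) (F : ((Fin d → ZMod L) → G) → ℝ≥0∞) :
    ∫⋯∫⁻_(spaceLinks d L₀ L), (fun U : Config d L₀ L G => F (polyakovLine U) *
        ∏ b : (Fin d → ZMod L) × Fin d, ringFactor ρ J b U) ∂(fun _ => haarProbability G) =
      fun U => F (polyakovLine U) * ∏ b : (Fin d → ZMod L) × Fin d,
        transferKernel ρ L₀ J (polyakovLine U b.1) (polyakovLine U (b.1 + Pi.single b.2 1)) := by
  classical
  have hdep : DependsOn (fun U : Config d L₀ L G => F (polyakovLine U))
      {e : FiniteTemperature.Site d L₀ L × Dir d | e.2 = none} := by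
    intro U V h
    show F (polyakovLine U) = F (polyakovLine V)
    rw [show polyakovLine U = polyakovLine V from
      funext fun y => timeHolonomy_eq_of_none_eq (fun x => h (x, none) rfl) _ _]
  have hsp : ∀ e ∈ spaceLinks d L₀ L, e ∉ {e : FiniteTemperature.Site d L₀ L × Dir d | e.2 = none} :=
    fun e he => by rw [mem_spaceLinks] at he; exact he
  rw [lmarginal_mul_left_of_dependsOn (spaceLinks d L₀ L) hdep hsp
    (Finset.measurable_prod _ fun b _ => measurable_ringFactor ρ hρ J b), spaceLinks_eq_biUnion_bondLinks,
    lmarginal_biUnion_prod_eq_prod Finset.univ bondLinks (ringSupport L₀) (ringFactor ρ J)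
      (measurable_ringFactor ρ hρ J) (dependsOn_ringFactor ρ J)
      (fun b _ b' _ hbb' e he => not_mem_ringSupport_of_mem_bondLinks hbb' he)
      (fun b _ b' _ hbb' => disjoint_bondLinks hbb')]
  funext U
  simp_rw [lmarginal_bondLinks_ringFactor ρ J _ U]

/-- The spin-model Boltzmann factor of one bond is measurable in the spin configuration. [cite: TomboulisYaffe1985, §III (3.11)–(3.12), p. 323] -/
theorem measurable_transferKernel_apply [NeZero L₀] (hρ : Continuous ρ) (J : ℝ)
    (b : (Fin d → ZMod L) × Fin d) :
    Measurable fun Ω : (Fin d → ZMod L) → G =>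
      transferKernel ρ L₀ J (Ω b.1) (Ω (b.1 + Pi.single b.2 1)) := by
  have h := (measurable_transferKernel (L₀ := L₀) ρ hρ J).comp
    ((measurable_pi_apply (X := fun _ : Fin d → ZMod L => G) b.1).prodMk
      (measurable_pi_apply (X := fun _ : Fin d → ZMod L => G) (b.1 + Pi.single b.2 1)))
  exact h

/-- The spin-model integrand `F(Ω) ∏_b K(Ω_y, Ω_{y'})` is measurable. [cite: TomboulisYaffe1985, §III (3.11)–(3.12), p. 323] -/
theorem measurable_mul_prod_transferKernel [NeZero L₀] [NeZero L] (hρ : Continuous ρ) (J : ℝ)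
    {F : ((Fin d → ZMod L) → G) → ℝ≥0∞} (hF : Measurable F) :
    Measurable fun Ω : (Fin d → ZMod L) → G => F Ω * ∏ b : (Fin d → ZMod L) × Fin d,
      transferKernel ρ L₀ J (Ω b.1) (Ω (b.1 + Pi.single b.2 1)) :=
  hF.mul (Finset.measurable_prod _ fun b _ => measurable_transferKernel_apply ρ hρ J b)

/-- **Tomboulis–Yaffe's transfer-matrix representation at zero space-like coupling** (3.11): for
every measurable `F ≥ 0` of the Polyakov lines,
`∫ F(Ω(U)) e^{J Σ_{P ∋ e_0} Re tr ρ(U_P)} ∏dU = ∫_{G^{Λ_s}} F(Ω) ∏_{⟨y, y+e_i⟩} K_{L₀}(Ω_y, Ω_{y+e_i}) ∏_x dΩ_x`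
— the finite-temperature theory with `J_M = 0` is a nearest-neighbour `G`-spin model for the
Polyakov lines with Haar single-spin measure and Boltzmann factor the transfer kernel. (Any compact
metrisable `G`, continuous `ρ`, `d`, `L₀, L ≥ 1`.) [cite: TomboulisYaffe1985, §III (3.11)–(3.12), p. 323] -/
theorem lintegral_polyakov_mul_weight_eq_lintegral_transferKernel [NeZero L₀] [NeZero L]
    (hρ : Continuous ρ) (J : ℝ) (F : ((Fin d → ZMod L) → G) → ℝ≥0∞) (hF : Measurable F) :
    ∫⁻ U, F (polyakovLine U) * ENNReal.ofReal (weight ρ J 0 U) ∂haar d L₀ L G =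
      ∫⁻ Ω, F Ω * ∏ b : (Fin d → ZMod L) × Fin d,
        transferKernel ρ L₀ J (Ω b.1) (Ω (b.1 + Pi.single b.2 1))
        ∂Measure.pi fun _ : Fin d → ZMod L => haarProbability G := by
  classical
  have hmΩ : Measurable fun U : Config d L₀ L G => polyakovLine U :=
    measurable_pi_lambda _ fun y' => (continuous_timeHolonomy _ _).measurable
  -- the gauge-fixed integrand and its measurability
  have hfm : Measurable fun U : Config d L₀ L G => F (polyakovLine U) *
      ∏ b : (Fin d → ZMod L) × Fin d, ringFactor ρ J b U :=
    (hF.comp hmΩ).mul (Finset.measurable_prod _ fun b _ => measurable_ringFactor ρ hρ J b)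
  -- Step 1: the temporal gauge
  have h1 : ∫⁻ U, F (polyakovLine U) * ENNReal.ofReal (weight ρ J 0 U) ∂haar d L₀ L G =
      ∫⁻ U, (fun U : Config d L₀ L G => F (polyakovLine U) *
        ∏ b : (Fin d → ZMod L) × Fin d, ringFactor ρ J b U) (temporalGaugeFix U) ∂haar d L₀ L G := by
    refine lintegral_congr fun U => ?_
    simp only
    rw [polyakovLine_temporalGaugeFix, ← ofReal_weight_temporalRep, ← weight_eq_weight_temporalRep]
  rw [h1, (measurePreserving_temporalGaugeFix (d := d) (L₀ := L₀) (L := L) (G := G)).lintegral_comp hfm]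
  -- Step 2: iterated marginals, time-like links outside, space-like links inside
  have x₀ : Config d L₀ L G := fun _ => 1
  have hΨ := measurable_mul_prod_transferKernel (L₀ := L₀) ρ hρ J hF
  have h4 := lmarginal_timeLinks_comp_polyakovLine (L₀ := L₀) (fun Ω : (Fin d → ZMod L) → G =>
    F Ω * ∏ b : (Fin d → ZMod L) × Fin d, transferKernel ρ L₀ J (Ω b.1) (Ω (b.1 + Pi.single b.2 1)))
    hΨ x₀
  rw [← h4, ← lmarginal_spaceLinks_polyakov_mul_ringFactors ρ hρ J F,
    ← lmarginal_union _ _ hfm disjoint_timeLinks_spaceLinks, timeLinks_union_spaceLinks,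
    ← lintegral_eq_lmarginal_univ x₀]
  rfl

end Assembly

end

end Literature.MathematicalPhysics.QuantumFieldTheory.TomboulisYaffeHighTemperature
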